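import Literature.MathematicalPhysics.QuantumFieldTheory.Balaban1983to89.B9Eq380CubeLetters
import Literature.MathematicalPhysics.QuantumFieldTheory.Balaban1983to89.B9Eq358TaxiLettersY

/-!
# `Balaban1983to89.B9Eq357CubeLetters` — T. Bałaban, *Propagators for lattice gauge theories in a background field*, Commun. Math. Phys. **99**
# (1985) 389–434 [Balaban1985BackgroundPropagators] (3.57)–(3.59) pp. 401–402 AT THE CUBE LETTERS `Q′_□ ∕ Q′*_□` of Sect. C p. 409
# (`B9CubeLettersBondOpsL0.QpCubeY ∕ QpsCubeY` at the record's site transporter `Node00.OpsYRecordV4.parSymY`): `Q′_□(U′U) = Q′_□(U) + F′₂`,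
# `Q′*_□(U′U) = Q′*_□(U) + F′₂*`, with `|(F′₂λ)(y)| ≦ O(1)·(Q′_□|λ|)(y)`-shaped bounds in two smallness currencies (sub-row G-B9-LETTERS, slot M5.1b-Q′ —
# the site-sector twin of `B9Eq380CubeLetters`)

statement-level skeleton of published theorems with citation tags; proofs where landed; nothing here is a claim about the Yang–Mills mass gap

THE PRINT (first-hand, `paper:balaban1985-cmp99-background-propagators` pp. 401–402 = PDF 13–14; the displays (3.55)–(3.58) are garbled on the text layer,
the prose is legible).  p. 401: *«Let us consider now the averaging operators Q′_j(U) given by (3.19). We have to find an expansion of R((U′U)(Γ^{(j)}_{y,x})).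
… (3.55) … We apply the identity (97) [5] … (3.56) … Using (102), (103) we get … (3.57).  Let us notice that the above expressions involve the gauge field
variables U′_b, U_b for b ⊂ B^j(y). … Applying the inequalities (161), (162) [5], we have … for α₁ sufficiently small. By Proposition 4 [5] the expression
on the right-hand side of (3.57) is an analytic function of A, and by the above bounds |(U′U)(Γ^{(j)}_{y,x})(U(Γ^{(j)}_{y,x}))⁻¹ − 1| < O(1)α₁. This implies
(U′U)(Γ^{(j)}_{y,x}) = R(U(Γ^{(j)}_{y,x})) + F′_{2,j}(A; y, x)»*;  p. 402: *«and |F′_{2,j}(A; y, x)| ≦ O(1)α₁, (3.58) hence finally (Q′_j(U′U)λ)(y) =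
(Q′_j(U)λ)(y) + (F′_{2,j}(A)λ)(y), (F′_{2,j}(A)λ)(y) = Σ_{x ∈ B^j(y)} L^{−jd} F′_{2,j}(A; y, x)λ(x), and |(F′_{2,j}(A)λ)(y)| ≦ O(1)α₁(Q̃′_j|λ|)(y). (3.59)
The operator F′_{2,j}(A) is an analytic function of A in the domain given by the inequality |A| < α₁(Lʲη)⁻¹ for α₁ sufficiently small.  We have a similar
expansion for the adjoint operator. We denote operators in this expansion by adding a star as a superscript. Let us remark that F′*_{2,j}(A) is not an
adjoint of F′_{2,j}(A).»*  (3.19) p. 393 (the averaging `Q′_j(U)`: transport to a reference point of the block, `R(U(Γ))`), (3.24) p. 394 (`Q′*` in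
`Q′*aQ′`), (3.40) p. 397 (*«Γ_{x,x′} is a shortest contour connecting points x and x′»*), p. 408 l. 42–43 + p. 409 l. 1–5 (the cube sequence `{Ω_n(□)}`
and its letters `G′_□(U), C_□(U), G_□(U)` *«correspondingly»*).

WHY THIS FILE (cell `lit-balaban`, sub-row G-B9-LETTERS of ROW G-B8-T2S, module-map slot **M5.1b-Q′** «(3.57)–(3.59) at the cube letters», opened by the
map owner r06 g67 2026-08-28T09:45:19Z (Q4) with first refusal to this seat, taken 10:26Z; `lit-balaban-r06/B9-LETTERS-MAP.md` §8).  The Sect.-B step for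
the cube operators needs, besides the bond-sector letters `Q_□ ∕ Q*_□` ((3.80)–(3.81), ✓ `B9Eq380CubeLetters`), the SITE-sector expansion (3.57)–(3.59):
`Q′_□` enters the bond operator `Δ_{a,□}(U)` through `R_□(U)` (`B9CubeLettersBondOpsL0.RCubeY`) and the site letters `G′_□`, `C_□` directly.  Its
consumers display it in the shape of r06's door `B9Thm34GUniformR1.thm34_G_clause_uniform` (binders `kF sF`, `hkF : ‖kF y x‖ ≤ C_q·α₁·w y`, `hsF :
‖sF x‖ ≤ C_q·α₁`) — ym-inputs-p02's M5.1b-G `B9Cor35GAtCubeLetters` (staged root `pub/ym-inputs/COR35G-STATEMENTS-p02.md` (A2)) and the unassigned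
site-sector glue `B9SectBStepAtCubeLetters`.  THE CUBE LETTERS: `QpCubeY i q parS U = trLiftY (qpKc i q) (qpTc i q parS U)` transports `λ(z)`, `z ∈ Δ(s)`,
to the CORNER of the cube-sequence block `s` along `parS` (`qpTc i q parS U s z = parS U c_s z`, `B9CubeLettersBondOpsL0` :111 ∕ :132 ∕ :135); at the
record's `parS := parSymY i` this is def-Y's TAXICAB contour variable `U(Γ_{c_s,z})` (the corner precedes `z` lexicographically, `qpTc_parSymY_of_blkOf_eq`)
— the DECLARED READING of N06's `B9Eq358TaxiLettersY` (member blocks) and of `B9Eq380CubeLetters` (bond sector): print's level-by-level composite contours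
(3.55)–(3.56) and the [5] = Balaban1985Averaging inputs (161)–(162) are cited, not reproduced; the key estimate is the elementary product ∕ telescoping
estimate along the `≤ (d+1)(L^{j(s)} − 1)` bonds of `Γ_{c_s,z}`, all based in `Δ(s)` (print: *«involve the gauge field variables … for b ⊂ B^j(y)»*).

WHAT IS PROVED (sorry-free; 0 `def`, 0 facts; `F′₂ := Q′_□(U′U) − Q′_□(U)`, `F′₂* := Q′*_□(U′U) − Q′*_□(U)` are written out, (3.57) being their definition).
* §1 THE BLOCKS OF THE CUBE SEQUENCE (`BlkCubeY i q` = the blocks of `(cubeFamY i q).toDomains`, levels `min(D.lev, prof_□)`, `B9CubeSequence408`):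
  the kernels `qpKc_of_blkOf_eq ∕ _ne` (`q′(s,z) = W(s)⁻¹·[z ∈ Δ(s)]`), `blkOf_of_qpKc_ne_zero`, `qpKc_nonneg`, `qpsKc_of_blkOf_eq ∕ _ne` (`q′*(z,s) =
  [z ∈ Δ(s)]`), `blkOf_of_qpsKc_ne_zero`, `qpsKc_nonneg`, `sum_abs_qpKc_mul_eq` (the row `Σ_z |q′(s,z)|‖λ(z)‖` IS print's `(Q̃′_j|λ|)(y)`); the geometry
  `pow_dvd_period_and_two_mul_le`, ★ `val_sub_corner` (torus counts from the corner = box differences `< L^{j(s)}`), `val_sub_corner_self`,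
  `toLex_corner_le`, ★ `blkOf_toBox_of_val_sub_lt`, ★ `blkOf_toBox_rung_eq` (EVERY RUNG OF THE CORNER→`z` TAXICAB PATH LIES IN `Δ(s)`),
  `length_taxiSteps_block_le`, ★ `tdist_corner_le` (`|Γ_{c_s,z}| ≤ (d+1)(L^{j(s)} − 1)`), `range_le_range_k` — N06's `B9Eq358TaxiLettersY` §3 (stated
  there for the member's blocks `i.D`) re-keyed to the cube sequence, proofs verbatim up to the family; N06's torus lemmas (`val_boxEquiv_symm_int`,
  `min_val_sub_le`) and n06-i's `B9Eq340TaxiRungs` BY NAME.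
* §2 CURRENCY U (the currency of `B9Eq380CubeLetters`: unitary-like `U, U′`, `‖U′(b) − 1‖ ≤ ρ` at the bonds based in the block; `D` any bound
  `≥ (d+1)(L^{j(s)} − 1)` — own-level, or the crude `(d+1)(Lᵏ − 1)`): `qpTc_parSymY_of_blkOf_eq`, `unitaryLike_qpTc_parSymY`, ★★
  `norm_parTaxiV_mul_sub_block_le` (`‖(U′U)(Γ) − U(Γ)‖ ≤ (d+1)(L^{j(s)} − 1)·ρ` inside the block — `B9Eq380CubeLetters.norm_stepRun_mul_sub_le` BY NAME on
  the rungs of §1), `norm_qpTc_mul_sub_le`, `norm_inv_qpTc_mul_sub_le`, and the printed statements: ★★★ `norm_QpCubeY_mul_sub_apply_le` — **(3.57)–(3.59)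
  for `Q′_□`**: `‖(Q′_□(U′U)λ − Q′_□(U)λ)(s)‖ ≤ 2Dρ · Σ_z |q′(s,z)|·‖λ(z)‖` (print's `O(1)α₁(Q̃′|λ|)(y)` with `O(1)α₁ = 2Dρ`; the own-level `ρ_s =
  O(1)α₁L^{−j(s)}` makes it level-free, as printed); ★★★ `norm_QpsCubeY_mul_sub_apply_le` — **the same for `Q′*_□`** (transporters inverted; «F′*₂ is
  not an adjoint of F′₂» respected: it is bounded on its own); the GLOBAL-smallness forms `…_of_forall` (`D = (d+1)(Lᵏ − 1)`); the BACKGROUND-`1` faces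
  ★★★ `norm_QpCubeY_sub_one_apply_le` ∕ `norm_QpsCubeY_sub_one_apply_le` ∕ `norm_QpCubeY_QpsCubeY_sub_one_apply_le_of_forall` (`U = 1`: the cube road
  of Cor. 3.5 ∕ 3.6, background gauged to `1` on `□̃`, `U′ = U^u` (3.37)-small — `B9Cor36GaugeReductionCube`); and THE LETTERS IN R1's SHAPE:
  `norm_Rclm_sub_le_of_unitaryLike` (`‖R(p′) − R(p)‖ ≤ 2‖p′ − p‖` as `ℝ`-continuous-linear letters, N06's `norm_Rclm_sub_le` + `T4RelativeLadder.norm_inv_sub_inv_le`),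
  ★★ `norm_kernelLetter_QpCubeY_mul_sub_le` (**(3.58) as `hkF`**: `‖q′(s,z)·(R((U′U)(Γ_{c_s,z})) − R(U(Γ_{c_s,z})))‖ ≤ 4Dρ·q′(s,z)`, i.e. `C_q·α₁ := 4Dρ`,
  `w(s) := W(s)⁻¹`), ★★ `norm_starLetter_QpsCubeY_mul_sub_le` (**the starred letter as `hsF`**: `‖R(((U′U)(Γ))⁻¹) − R((U(Γ))⁻¹)‖ ≤ 4Dρ` on the block).
* §3 CURRENCY A (N06's: `U` `G`-valued with `‖G‖ ≤ 1`, the multiplier `e^{iηa} = mulY i (fluct η a) U` with the block's OWN-LEVEL (3.37) `η‖a_ν(v)‖ ≤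
  α₁L^{−j(s)}` at the bonds based in `Δ(s)` — complex `a` allowed (the analyticity domain) — and `α₁ ≤ 1/4`): ★★ `norm_parTaxiV_prod_sub_block_le` (THE KEY
  ESTIMATE of p. 401 for the cube sequence's blocks: `‖(e^{iηa}U)(Γ) − U(Γ)‖ ≤ 2(d+1)e^{(d+1)/2}α₁`, the inverse and the two norms — N06's §1 product
  lemmas and `pow_bounds` BY NAME on the rungs of §1), ★★ `norm_Rclm_qpTc_prod_sub_le` (**(3.58)**: both letter differences `≤ 4(d+1)e^{3(d+1)/2}·α₁`),
  `norm_trLiftY_sub_apply_le_of_Rclm` (the transported lift is Lipschitz through the `ℝ`-linear letters — no unitarity of the transporters needed), ★★★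
  `norm_QpCubeY_prod_sub_apply_le` ∕ `norm_QpsCubeY_prod_sub_apply_le` (**(3.59) for `Q′_□ ∕ Q′*_□`** with the LEVEL-FREE `O(1) = 4(d+1)e^{3(d+1)/2}`),
  ★★ `norm_kernelLetter_QpCubeY_prod_sub_le` (`hkF` in currency A: `C_q := 4(d+1)e^{3(d+1)/2}`, `w(s) := W(s)⁻¹`).

HONEST SCOPE.  Finite lattice algebra and one induction along def-Y's taxicab contour (n06-i's signed step runs); the smallness is a HYPOTHESIS in either
currency (U: bondwise `‖U′(b) − 1‖ ≤ ρ` on the block — on the cube road the face of p21's `Small337OnCube`; A: the pointwise own-level (3.37) on the block),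
supplied by the consumer; the transporter is def-Y's corner taxicab contour, not print's composite `Γ^{(j)}_{y,x}` of (3.55) (DECLARED READING, as N06's and
def-Y's `Q′`); nothing of [5] ((97), (102)–(103), (161)–(162), Prop. 4) and none of the analyticity statements is asserted or used; the rows `Σ_z |q′(s,z)|‖λ(z)‖`
are left as they are (print's `Q̃′|λ|`; the consumer's majorant currency absorbs them).  Count-neutral; NOT a node discharge; no summit ∕ sub-problem statement
is proved; nothing continuum ∕ mass gap ∕ Clay.  Cell `lit-balaban`, seat `lit-balaban-r05` gen 82 (explicit-unit), 2026-08-28; `--supports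
stmt-QuantumFields-19200` as helper.  NEW file; nothing landed is modified.  Net new unproved facts: 0.
-/

noncomputable section

namespace Literature.MathematicalPhysics.QuantumFieldTheory.Balaban1983to89.B9Eq357CubeLetters

open LatticeFieldCalculus
open Node00
open B4Reflection242 (boxDom mem_boxDom blk)
open B6MultiLevelBoxOperator (N0)
open B6Geom246MultiLevelBoxL0 (blkOf blkOf_eq_iff_blk coord_bounds corner corner_mem scale_bounds)
open B6Ineq268MultiLevelBoxL0 (W W_pos)
open B6GlobalChartV1 (PV toBox boxEquiv toBox_apply boxEquiv_apply val_boxEquiv_symm)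
open B6KLevelCensusIndexV1 (KIdx)
open B6Cover236MultiLevelBlocks (cubes)
open B9CubeLettersOpsL0 (cubeFamY)
open B9CubeLettersBondOpsL0 (BlkCubeY qpKc qpsKc qpTc blkCornerCubeY QpCubeY QpsCubeY)
open B9Eq39Adjoint (R)
open T4RelativeLadder (UnitaryLike)
open B9Eq340StepLasso (stepRun rungSites taxiSteps parTaxiV_eq_stepRun unitaryLike_stepRun)
open B9Eq340TaxiRungs (rungSites_taxiSteps onArc_mem_interval length_taxiSteps_le)
open B9Eq340TaxiTelescope (length_taxiSteps_eq_tdist)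
open B9Eq380CubeLetters (norm_stepRun_mul_sub_le unitaryLike_parTaxiV' norm_trLiftY_sub_apply_le trLiftY_sub_trLiftY_apply
  norm_R_sub_R_le_of_unitaryLike mul_one_cfg)
open B9Eq358TaxiLettersY (val_boxEquiv_symm_int min_val_sub_le norm_Rclm_sub_le norm_stepRun_prod_le norm_inv_stepRun_prod_le norm_stepRun_prod_sub_le
  norm_inv_stepRun_prod_sub_le pow_bounds norm_fluct_sub_one_le)
open B9Eq360DeltaPrimeAY (Rclm Rclm_apply mulY AfldY)
open B9Eq39Adjoint (fluct)
open B9SectBGpLettersY (norm_le_one_and_inv_of_mem)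

variable {d ℓ : ℕ} {hd : 1 ≤ d + 1} {hL : Odd (ℓ + 1) ∧ 1 < ℓ + 1} {b₀ b₁ : ℝ}

/-! ## §1 The blocks of the cube sequence: kernels, corners, taxicab contours inside a block -/

section Geometry

variable (i : KIdx d ℓ hd hL b₀ b₁) (q : ↥(cubes (toKT i).D.toDomains))

/-- the kernel of `Q′_□` on its block: `q′(s, z) = W(s)⁻¹` for `z ∈ Δ(s)`. [cite: Balaban1985BackgroundPropagators, (3.19) p.393, (3.21) p.394; Balaban1984PropagatorsII, (2.14) p.225] -/
theorem qpKc_of_blkOf_eq {s : BlkCubeY i q} {z : SiteY i} (h : blkOf (cubeFamY i q).toDomains z = s) :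
    qpKc i q s z = (W (cubeFamY i q).toDomains s)⁻¹ := by
  change B6Ineq288MultiLevelTorusL0.QM (cubeFamY i q) s z = _
  unfold B6Ineq288MultiLevelTorusL0.QM
  rw [if_pos h]

/-- the kernel of `Q′_□` vanishes off the block. [cite: Balaban1985BackgroundPropagators, (3.19) p.393; Balaban1984PropagatorsII, (2.14) p.225] -/
theorem qpKc_of_blkOf_ne {s : BlkCubeY i q} {z : SiteY i} (h : blkOf (cubeFamY i q).toDomains z ≠ s) : qpKc i q s z = 0 := by
  change B6Ineq288MultiLevelTorusL0.QM (cubeFamY i q) s z = _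
  unfold B6Ineq288MultiLevelTorusL0.QM
  rw [if_neg h]

/-- the support of the kernel of `Q′_□`: `q′(s, z) ≠ 0 ⟹ z ∈ Δ(s)`. [cite: Balaban1985BackgroundPropagators, (3.19) p.393; Balaban1984PropagatorsII, (2.14) p.225] -/
theorem blkOf_of_qpKc_ne_zero {s : BlkCubeY i q} {z : SiteY i} (h : qpKc i q s z ≠ 0) : blkOf (cubeFamY i q).toDomains z = s := by
  by_contra h'
  exact h (qpKc_of_blkOf_ne i q h')

/-- `q′(s, z) ≥ 0`. [cite: Balaban1985BackgroundPropagators, (3.19) p.393, bookkeeping] -/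
theorem qpKc_nonneg (s : BlkCubeY i q) (z : SiteY i) : 0 ≤ qpKc i q s z := by
  by_cases h : blkOf (cubeFamY i q).toDomains z = s
  · rw [qpKc_of_blkOf_eq i q h]; exact inv_nonneg.2 (W_pos _ s).le
  · rw [qpKc_of_blkOf_ne i q h]

/-- the kernel of `Q′*_□` (block-constant extension): `q′*(z, s) = 1` for `z ∈ Δ(s)`. [cite: Balaban1985BackgroundPropagators, (3.24) p.394 (Q′*); Balaban1984PropagatorsII, (2.69) p.235] -/
theorem qpsKc_of_blkOf_eq {z : SiteY i} {s : BlkCubeY i q} (h : blkOf (cubeFamY i q).toDomains z = s) : qpsKc i q z s = 1 := by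
  change B6Ineq288MultiLevelTorusL0.QsM (cubeFamY i q) z s = _
  unfold B6Ineq288MultiLevelTorusL0.QsM
  rw [if_pos h]

/-- the kernel of `Q′*_□` vanishes off the block. [cite: Balaban1985BackgroundPropagators, (3.24) p.394; Balaban1984PropagatorsII, (2.69) p.235] -/
theorem qpsKc_of_blkOf_ne {z : SiteY i} {s : BlkCubeY i q} (h : blkOf (cubeFamY i q).toDomains z ≠ s) : qpsKc i q z s = 0 := by
  change B6Ineq288MultiLevelTorusL0.QsM (cubeFamY i q) z s = _
  unfold B6Ineq288MultiLevelTorusL0.QsM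
  rw [if_neg h]

/-- the support of the kernel of `Q′*_□`: `q′*(z, s) ≠ 0 ⟹ z ∈ Δ(s)`. [cite: Balaban1985BackgroundPropagators, (3.24) p.394; Balaban1984PropagatorsII, (2.69) p.235] -/
theorem blkOf_of_qpsKc_ne_zero {z : SiteY i} {s : BlkCubeY i q} (h : qpsKc i q z s ≠ 0) : blkOf (cubeFamY i q).toDomains z = s := by
  by_contra h'
  exact h (qpsKc_of_blkOf_ne i q h')

/-- `q′*(z, s) ≥ 0`. [cite: Balaban1985BackgroundPropagators, (3.24) p.394, bookkeeping] -/
theorem qpsKc_nonneg (z : SiteY i) (s : BlkCubeY i q) : 0 ≤ qpsKc i q z s := by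
  by_cases h : blkOf (cubeFamY i q).toDomains z = s
  · rw [qpsKc_of_blkOf_eq i q h]; exact zero_le_one
  · rw [qpsKc_of_blkOf_ne i q h]

/-- the row of `|q′(s, ·)|·‖λ‖` IS the block mean `(Q′_□‖λ‖)(s) = W(s)⁻¹ Σ_{z ∈ Δ(s)} ‖λ(z)‖` — print's `(Q̃′_j|λ|)(y)` of (3.59).
[cite: Balaban1985BackgroundPropagators, (3.59) p.402, (3.19) p.393] -/
theorem sum_abs_qpKc_mul_eq {E : Type*} [SeminormedAddCommGroup E] (s : BlkCubeY i q) (lam : SiteY i → E) :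
    ∑ z, |qpKc i q s z| * ‖lam z‖ = ∑ z, qpKc i q s z * ‖lam z‖ :=
  Finset.sum_congr rfl fun z _ => by rw [abs_of_nonneg (qpKc_nonneg i q s z)]

/-- the period is a multiple of `Lʲ` for every block level `j ≤ k` of the cube sequence, and `2Lʲ ≤ period`.
[cite: Balaban1984PropagatorsII, (2.1) p.224; Balaban1985BackgroundPropagators, p.408, bookkeeping] -/
theorem pow_dvd_period_and_two_mul_le (s : BlkCubeY i q) :
    ((ℓ + 1) ^ s.1.1 ∣ (PV d ℓ i.m i.K hd hL).sitesPerDir 0) ∧ 2 * (ℓ + 1) ^ s.1.1 ≤ (PV d ℓ i.m i.K hd hL).sitesPerDir 0 := by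
  have hj : s.1.1 ≤ i.k := (scale_bounds (cubeFamY i q).toDomains s).2
  rw [← i.hN 0]
  show ((ℓ + 1) ^ s.1.1 ∣ (ℓ + 1) ^ i.k * ((ℓ + 1) * (i.Mh * i.P' 0))) ∧ 2 * (ℓ + 1) ^ s.1.1 ≤ (ℓ + 1) ^ i.k * ((ℓ + 1) * (i.Mh * i.P' 0))
  refine ⟨Dvd.dvd.mul_right (pow_dvd_pow _ hj) _, ?_⟩
  have h8 : 8 ≤ i.Mh := i.hM8
  have h5 : 5 ≤ i.P' 0 := i.hP5 0
  have hpow : (ℓ + 1) ^ s.1.1 ≤ (ℓ + 1) ^ i.k := Nat.pow_le_pow_right (by omega) hj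
  have h40 : 40 ≤ i.Mh * i.P' 0 := le_trans (by norm_num) (Nat.mul_le_mul h8 h5)
  have h40' : 40 ≤ (ℓ + 1) * (i.Mh * i.P' 0) := le_trans h40 (Nat.le_mul_of_pos_left _ (by omega))
  calc 2 * (ℓ + 1) ^ s.1.1 ≤ 2 * (ℓ + 1) ^ i.k := Nat.mul_le_mul_left _ hpow
    _ ≤ ((ℓ + 1) * (i.Mh * i.P' 0)) * (ℓ + 1) ^ i.k := Nat.mul_le_mul_right _ (le_trans (by norm_num) h40')
    _ = (ℓ + 1) ^ i.k * ((ℓ + 1) * (i.Mh * i.P' 0)) := by ring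

/-- **THE TORUS COUNTS FROM THE CORNER OF A CUBE-SEQUENCE BLOCK ARE THE BOX DIFFERENCES**: for `z ∈ Δ(s)`, with `p`, `t` the torus points of the corner
`c_s` and of `z`, `((t_μ − p_μ).val : ℤ) = z_μ − c_μ` and `(t_μ − p_μ).val < Lʲ⁽ˢ⁾`. [cite: Balaban1984PropagatorsII, (2.1) p.224; Balaban1985BackgroundPropagators, p.408, dictionary] -/
theorem val_sub_corner (s : BlkCubeY i q) {z : SiteY i} (hz : blkOf (cubeFamY i q).toDomains z = s) (μ : Fin (d + 1)) :
    (((((boxEquiv i.hN).symm z) μ - ((boxEquiv i.hN).symm (blkCornerCubeY i q s)) μ).val : ℕ) : ℤ) = z.1 μ - corner (cubeFamY i q).toDomains s μ ∧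
      (((boxEquiv i.hN).symm z) μ - ((boxEquiv i.hN).symm (blkCornerCubeY i q s)) μ).val < (ℓ + 1) ^ s.1.1 := by
  obtain ⟨h1, h2⟩ := coord_bounds (cubeFamY i q).toDomains hz μ
  have hc : corner (cubeFamY i q).toDomains s μ = (((ℓ + 1) ^ s.1.1 : ℕ) : ℤ) * s.1.2 μ := rfl
  have ht : ((((boxEquiv i.hN).symm z) μ).val : ℤ) = z.1 μ := val_boxEquiv_symm_int i z μ
  have hp : ((((boxEquiv i.hN).symm (blkCornerCubeY i q s)) μ).val : ℤ) = corner (cubeFamY i q).toDomains s μ :=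
    val_boxEquiv_symm_int i (blkCornerCubeY i q s) μ
  have hle : (((boxEquiv i.hN).symm (blkCornerCubeY i q s)) μ).val ≤ (((boxEquiv i.hN).symm z) μ).val := by
    have : ((((boxEquiv i.hN).symm (blkCornerCubeY i q s)) μ).val : ℤ) ≤ ((((boxEquiv i.hN).symm z) μ).val : ℤ) := by rw [ht, hp, hc]; exact h1
    exact_mod_cast this
  have hsub := ZMod.val_sub hle
  have e : (((((boxEquiv i.hN).symm z) μ - ((boxEquiv i.hN).symm (blkCornerCubeY i q s)) μ).val : ℕ) : ℤ) = z.1 μ - corner (cubeFamY i q).toDomains s μ := by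
    rw [hsub, Nat.cast_sub hle, ht, hp]
  refine ⟨e, ?_⟩
  have : (((((boxEquiv i.hN).symm z) μ - ((boxEquiv i.hN).symm (blkCornerCubeY i q s)) μ).val : ℕ) : ℤ) < (((ℓ + 1) ^ s.1.1 : ℕ) : ℤ) := by
    rw [e, hc]; linarith
  exact_mod_cast this

/-- the corner's own torus point is within `Lʲ` steps of itself. [cite: Balaban1984PropagatorsII, (2.1) p.224, bookkeeping] -/
theorem val_sub_corner_self (s : BlkCubeY i q) (μ : Fin (d + 1)) :
    (((boxEquiv i.hN).symm (blkCornerCubeY i q s)) μ - ((boxEquiv i.hN).symm (blkCornerCubeY i q s)) μ).val < (ℓ + 1) ^ s.1.1 := by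
  rw [sub_self, ZMod.val_zero]; positivity

/-- the corner precedes every site of its block in the lexicographic order of the box chart. [cite: Balaban1984PropagatorsII, (2.1) p.224, bookkeeping] -/
theorem toLex_corner_le (s : BlkCubeY i q) {z : SiteY i} (hz : blkOf (cubeFamY i q).toDomains z = s) : toLex (blkCornerCubeY i q s).1 ≤ toLex z.1 :=
  Pi.toLex_monotone fun μ => (coord_bounds (cubeFamY i q).toDomains hz μ).1

/-- ★ **A TORUS POINT WITHIN `Lʲ` FORWARD STEPS OF THE CORNER LIES IN THE BLOCK** (cube sequence). [cite: Balaban1984PropagatorsII, (2.1) p.224; Balaban1985BackgroundPropagators, p.408, dictionary] -/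
theorem blkOf_toBox_of_val_sub_lt (s : BlkCubeY i q) (u : Site (PV d ℓ i.m i.K hd hL) 0)
    (hu : ∀ μ, (u μ - ((boxEquiv i.hN).symm (blkCornerCubeY i q s)) μ).val < (ℓ + 1) ^ s.1.1) :
    blkOf (cubeFamY i q).toDomains (toBox i.hN u) = s := by
  set p := (boxEquiv i.hN).symm (blkCornerCubeY i q s) with hpdef
  have hLj0 : 0 < (ℓ + 1) ^ s.1.1 := by positivity
  have hLz : (0 : ℤ) < (((ℓ + 1) ^ s.1.1 : ℕ) : ℤ) := by exact_mod_cast hLj0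
  obtain ⟨hdvd, -⟩ := pow_dvd_period_and_two_mul_le i q s
  rw [blkOf_eq_iff_blk]
  funext μ
  have hc : corner (cubeFamY i q).toDomains s μ = (((ℓ + 1) ^ s.1.1 : ℕ) : ℤ) * s.1.2 μ := rfl
  have hp : (((p μ).val : ℕ) : ℤ) = corner (cubeFamY i q).toDomains s μ := val_boxEquiv_symm_int i (blkCornerCubeY i q s) μ
  have hcmem := (mem_boxDom.1 (blkCornerCubeY i q s).2) μ
  have hN : (toKT i).NB μ = (PV d ℓ i.m i.K hd hL).sitesPerDir 0 := i.hN μ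
  have hcN : corner (cubeFamY i q).toDomains s μ < (((PV d ℓ i.m i.K hd hL).sitesPerDir 0 : ℕ) : ℤ) := by
    have h : corner (cubeFamY i q).toDomains s μ < (((toKT i).NB μ : ℕ) : ℤ) := hcmem.2
    rw [hN] at h
    exact h
  have hcL : corner (cubeFamY i q).toDomains s μ + (((ℓ + 1) ^ s.1.1 : ℕ) : ℤ) ≤ (((PV d ℓ i.m i.K hd hL).sitesPerDir 0 : ℕ) : ℤ) := by
    obtain ⟨N', hN'⟩ := hdvd
    rw [hN', hc, Nat.cast_mul] at hcN ⊢
    have hy : s.1.2 μ < (N' : ℤ) := lt_of_mul_lt_mul_left hcN hLz.le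
    have hy' : s.1.2 μ + 1 ≤ (N' : ℤ) := hy
    calc (((ℓ + 1) ^ s.1.1 : ℕ) : ℤ) * s.1.2 μ + (((ℓ + 1) ^ s.1.1 : ℕ) : ℤ) = (((ℓ + 1) ^ s.1.1 : ℕ) : ℤ) * (s.1.2 μ + 1) := by ring
      _ ≤ (((ℓ + 1) ^ s.1.1 : ℕ) : ℤ) * (N' : ℤ) := mul_le_mul_of_nonneg_left hy' hLz.le
  have hrL : (((u μ - p μ).val : ℕ) : ℤ) < (((ℓ + 1) ^ s.1.1 : ℕ) : ℤ) := by exact_mod_cast hu μ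
  have hsum : (u μ).val = (u μ - p μ).val + (p μ).val := by
    have hlt : (u μ - p μ).val + (p μ).val < (PV d ℓ i.m i.K hd hL).sitesPerDir 0 := by
      have : (((u μ - p μ).val + (p μ).val : ℕ) : ℤ) < (((PV d ℓ i.m i.K hd hL).sitesPerDir 0 : ℕ) : ℤ) := by
        rw [Nat.cast_add, hp]; linarith
      exact_mod_cast this
    have := ZMod.val_add_of_lt hlt
    rwa [sub_add_cancel] at this
  have hcoord : (toBox i.hN u : Fin (d + 1) → ℤ) μ = (((u μ - p μ).val : ℕ) : ℤ) + corner (cubeFamY i q).toDomains s μ := by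
    rw [toBox_apply, hsum, Nat.cast_add, hp]
  show (toBox i.hN u : Fin (d + 1) → ℤ) μ / (((ℓ + 1) ^ s.1.1 : ℕ) : ℤ) = s.1.2 μ
  rw [hcoord, hc, Int.add_mul_ediv_left _ _ hLz.ne']
  have hr0 : (0 : ℤ) ≤ (((u μ - p μ).val : ℕ) : ℤ) := by positivity
  rw [Int.ediv_eq_zero_of_lt hr0 hrL, zero_add]

/-- ★ **EVERY RUNG OF A TAXICAB PATH BETWEEN TWO POINTS OF A CUBE-SEQUENCE BLOCK LIES IN THE BLOCK** (the contour variables of `Q′_□` «involve the gauge field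
variables U′_b, U_b for b ⊂ B^j(y)», p. 401). [cite: Balaban1985BackgroundPropagators, p.401, (3.19) p.393, (3.40) p.397; Balaban1984PropagatorsII, (2.1) p.224] -/
theorem blkOf_toBox_rung_eq (s : BlkCubeY i q) (x₁ x₂ : Site (PV d ℓ i.m i.K hd hL) 0)
    (h₁ : ∀ μ, (x₁ μ - ((boxEquiv i.hN).symm (blkCornerCubeY i q s)) μ).val < (ℓ + 1) ^ s.1.1)
    (h₂ : ∀ μ, (x₂ μ - ((boxEquiv i.hN).symm (blkCornerCubeY i q s)) μ).val < (ℓ + 1) ^ s.1.1)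
    (r : Site (PV d ℓ i.m i.K hd hL) 0 × Fin (d + 1) × Bool)
    (hr : r ∈ rungSites (taxiSteps (List.finRange (d + 1)) x₁ x₂) x₁) :
    blkOf (cubeFamY i q).toDomains (toBox i.hN r.1) = s := by
  obtain ⟨-, h2⟩ := pow_dvd_period_and_two_mul_le i q s
  obtain ⟨-, -, hon⟩ := rungSites_taxiSteps x₂ (List.finRange (d + 1)) (List.nodup_finRange _) x₁ r hr
  refine blkOf_toBox_of_val_sub_lt i q s r.1 fun μ => ?_
  exact onArc_mem_interval h2 (h₁ μ) (h₂ μ) (hon μ (List.mem_finRange μ)).1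

/-- the taxicab contour between two points of a cube-sequence block of level `j` has at most `(d+1)(Lʲ − 1)` bonds.
[cite: Balaban1985BackgroundPropagators, (3.40) p.397, (3.19) p.393; Balaban1984PropagatorsII, (2.1) p.224] -/
theorem length_taxiSteps_block_le (s : BlkCubeY i q) (x₁ x₂ : Site (PV d ℓ i.m i.K hd hL) 0)
    (h₁ : ∀ μ, (x₁ μ - ((boxEquiv i.hN).symm (blkCornerCubeY i q s)) μ).val < (ℓ + 1) ^ s.1.1)
    (h₂ : ∀ μ, (x₂ μ - ((boxEquiv i.hN).symm (blkCornerCubeY i q s)) μ).val < (ℓ + 1) ^ s.1.1) :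
    (taxiSteps (List.finRange (d + 1)) x₁ x₂).length ≤ (d + 1) * ((ℓ + 1) ^ s.1.1 - 1) := by
  have hlen := length_taxiSteps_le x₁ x₂ (fun μ => min_val_sub_le (h₁ μ) (h₂ μ)) (List.finRange (d + 1))
  rwa [List.length_finRange] at hlen

/-- ★ **THE CONTOUR OF `Q′_□` IS SHORT**: `|Γ_{c_s, z}| = |c_s − z|₁ ≤ (d+1)(Lʲ⁽ˢ⁾ − 1)` for `z ∈ Δ(s)`.
[cite: Balaban1985BackgroundPropagators, (3.19) p.393, (3.40) p.397, p.401; Balaban1984PropagatorsII, (2.1) p.224] -/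
theorem tdist_corner_le (s : BlkCubeY i q) {z : SiteY i} (hz : blkOf (cubeFamY i q).toDomains z = s) :
    Site.tdist ((boxEquiv i.hN).symm (blkCornerCubeY i q s)) ((boxEquiv i.hN).symm z) ≤ (d + 1) * ((ℓ + 1) ^ s.1.1 - 1) := by
  rw [← length_taxiSteps_eq_tdist]
  exact length_taxiSteps_block_le i q s _ _ (val_sub_corner_self i q s) fun μ => (val_sub_corner i q s hz μ).2

/-- `(d+1)(Lʲ⁽ˢ⁾ − 1) ≤ (d+1)(Lᵏ − 1)`: the crude, level-free range. [cite: Balaban1984PropagatorsII, (2.3)–(2.4) p.224, bookkeeping] -/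
theorem range_le_range_k (s : BlkCubeY i q) : (d + 1) * ((ℓ + 1) ^ s.1.1 - 1) ≤ (d + 1) * ((ℓ + 1) ^ i.k - 1) := by
  have hj : s.1.1 ≤ i.k := (scale_bounds (cubeFamY i q).toDomains s).2
  have hpow : (ℓ + 1) ^ s.1.1 ≤ (ℓ + 1) ^ i.k := Nat.pow_le_pow_right (by omega) hj
  exact Nat.mul_le_mul_left _ (by omega)

end Geometry

/-! ## §2 The transporters of `Q′_□ ∕ Q′*_□` at the record's `parSymY`, and CURRENCY U: (3.57)–(3.59) for unitary-like `U, U′` with `‖U′(b) − 1‖ ≤ ρ` on the block -/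

section CurrencyU

variable {𝔸 : Type} [NormedRing 𝔸] [NormedAlgebra ℂ 𝔸] [CompleteSpace 𝔸]
variable (i : KIdx d ℓ hd hL b₀ b₁) (q : ↥(cubes (toKT i).D.toDomains))

/-- dictionary: ON ITS BLOCK the transporter of `Q′_□(U)` at the record's symmetrised site transporter `parSymY` IS def-Y's taxicab contour variable from the
corner, `U(Γ_{c_s, z})` (the corner precedes `z`, so the `≤` branch of `parSymY`). [cite: Balaban1985BackgroundPropagators, (3.19) p.393, (3.40) p.397, dictionary] -/
theorem qpTc_parSymY_of_blkOf_eq (U : CfgY 𝔸 i) (s : BlkCubeY i q) {z : SiteY i} (hz : blkOf (cubeFamY i q).toDomains z = s) :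
    qpTc i q (parSymY i) U s z = parTaxiV U ((boxEquiv i.hN).symm (blkCornerCubeY i q s)) ((boxEquiv i.hN).symm z) := by
  show parSymY i U (blkCornerCubeY i q s) z = _
  rw [parSymY_of_le (toLex_corner_le i q s hz)]
  rfl

variable [NormOneClass 𝔸]

/-- the transporters of `Q′_□(U)` on the block are unitary-like for unitary-like `U`. [cite: Balaban1985BackgroundPropagators, (3.19) p.393, (3.40) p.397, bookkeeping] -/
theorem unitaryLike_qpTc_parSymY {U : CfgY 𝔸 i} (hU : ∀ μ x, UnitaryLike (U μ x)) (s : BlkCubeY i q) {z : SiteY i}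
    (hz : blkOf (cubeFamY i q).toDomains z = s) : UnitaryLike (qpTc i q (parSymY i) U s z) := by
  rw [qpTc_parSymY_of_blkOf_eq i q U s hz]
  exact unitaryLike_parTaxiV' hU _ _

/-- ★★ **THE KEY ESTIMATE, CURRENCY U**: for unitary-like `U, U′` with `‖U′(b) − 1‖ ≤ ρ` at every bond `b` based in the block `Δ(s)` of the cube sequence, and two
torus points `x₁, x₂` within `Lʲ⁽ˢ⁾` forward steps of the corner (e.g. the corner and a site of the block): along the taxicab contour, whose rungs all lie in
`Δ(s)`, `‖(U′U)(Γ_{x₁,x₂}) − U(Γ_{x₁,x₂})‖ ≤ (d+1)(Lʲ⁽ˢ⁾ − 1)·ρ`. [cite: Balaban1985BackgroundPropagators, p.401 («|(U′U)(Γ)(U(Γ))⁻¹ − 1| < O(1)α₁»), (3.40) p.397] -/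
theorem norm_parTaxiV_mul_sub_block_le {U V : CfgY 𝔸 i} (hU : ∀ μ x, UnitaryLike (U μ x)) (hV : ∀ μ x, UnitaryLike (V μ x)) {ρ : ℝ} (hρ : 0 ≤ ρ)
    (s : BlkCubeY i q)
    (hsmall : ∀ (ν : Fin (d + 1)) (v : Site (PV d ℓ i.m i.K hd hL) 0), blkOf (cubeFamY i q).toDomains (toBox i.hN v) = s → ‖(V ν v : 𝔸) - 1‖ ≤ ρ)
    (x₁ x₂ : Site (PV d ℓ i.m i.K hd hL) 0)
    (h₁ : ∀ μ, (x₁ μ - ((boxEquiv i.hN).symm (blkCornerCubeY i q s)) μ).val < (ℓ + 1) ^ s.1.1)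
    (h₂ : ∀ μ, (x₂ μ - ((boxEquiv i.hN).symm (blkCornerCubeY i q s)) μ).val < (ℓ + 1) ^ s.1.1) :
    ‖(parTaxiV (fun μ x => V μ x * U μ x) x₁ x₂ : 𝔸) - (parTaxiV U x₁ x₂ : 𝔸)‖ ≤ (((d + 1) * ((ℓ + 1) ^ s.1.1 - 1) : ℕ) : ℝ) * ρ := by
  have h := norm_stepRun_mul_sub_le hU hV hρ (taxiSteps (List.finRange (d + 1)) x₁ x₂) x₁
    fun r hr => hsmall r.2.1 r.1 (blkOf_toBox_rung_eq i q s x₁ x₂ h₁ h₂ r hr)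
  rw [← parTaxiV_eq_stepRun, ← parTaxiV_eq_stepRun] at h
  refine h.trans (mul_le_mul_of_nonneg_right ?_ hρ)
  exact_mod_cast length_taxiSteps_block_le i q s x₁ x₂ h₁ h₂

/-- ★★ **THE TRANSPORTER OF `Q′_□` AT `U′U` IS CLOSE TO THE ONE AT `U`** on the block: `‖(U′U)(Γ_{c_s,z}) − U(Γ_{c_s,z})‖ ≤ (d+1)(Lʲ⁽ˢ⁾ − 1)·ρ` for `z ∈ Δ(s)`.
[cite: Balaban1985BackgroundPropagators, (3.57)–(3.58) pp.401–402, (3.19) p.393, (3.40) p.397] -/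
theorem norm_qpTc_mul_sub_le {U V : CfgY 𝔸 i} (hU : ∀ μ x, UnitaryLike (U μ x)) (hV : ∀ μ x, UnitaryLike (V μ x)) {ρ : ℝ} (hρ : 0 ≤ ρ)
    (s : BlkCubeY i q)
    (hsmall : ∀ (ν : Fin (d + 1)) (v : Site (PV d ℓ i.m i.K hd hL) 0), blkOf (cubeFamY i q).toDomains (toBox i.hN v) = s → ‖(V ν v : 𝔸) - 1‖ ≤ ρ)
    {z : SiteY i} (hz : blkOf (cubeFamY i q).toDomains z = s) :
    ‖(qpTc i q (parSymY i) (fun μ x => V μ x * U μ x) s z : 𝔸) - (qpTc i q (parSymY i) U s z : 𝔸)‖ ≤ (((d + 1) * ((ℓ + 1) ^ s.1.1 - 1) : ℕ) : ℝ) * ρ := by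
  rw [qpTc_parSymY_of_blkOf_eq i q _ s hz, qpTc_parSymY_of_blkOf_eq i q _ s hz]
  exact norm_parTaxiV_mul_sub_block_le i q hU hV hρ s hsmall _ _ (val_sub_corner_self i q s) fun μ => (val_sub_corner i q s hz μ).2

/-- the inverse transporters (those of `Q′*_□`) are as close: `‖((U′U)(Γ_{c_s,z}))⁻¹ − (U(Γ_{c_s,z}))⁻¹‖ ≤ (d+1)(Lʲ⁽ˢ⁾ − 1)·ρ` for `z ∈ Δ(s)`.
[cite: Balaban1985BackgroundPropagators, (3.59) p.402 («a similar expansion for the adjoint operator»), (3.40) p.397] -/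
theorem norm_inv_qpTc_mul_sub_le {U V : CfgY 𝔸 i} (hU : ∀ μ x, UnitaryLike (U μ x)) (hV : ∀ μ x, UnitaryLike (V μ x)) {ρ : ℝ} (hρ : 0 ≤ ρ)
    (s : BlkCubeY i q)
    (hsmall : ∀ (ν : Fin (d + 1)) (v : Site (PV d ℓ i.m i.K hd hL) 0), blkOf (cubeFamY i q).toDomains (toBox i.hN v) = s → ‖(V ν v : 𝔸) - 1‖ ≤ ρ)
    {z : SiteY i} (hz : blkOf (cubeFamY i q).toDomains z = s) :
    ‖(((qpTc i q (parSymY i) (fun μ x => V μ x * U μ x) s z)⁻¹ : 𝔸ˣ) : 𝔸) - (((qpTc i q (parSymY i) U s z)⁻¹ : 𝔸ˣ) : 𝔸)‖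
      ≤ (((d + 1) * ((ℓ + 1) ^ s.1.1 - 1) : ℕ) : ℝ) * ρ := by
  have hVU : ∀ μ x, UnitaryLike (V μ x * U μ x) := fun μ x => (hV μ x).mul (hU μ x)
  exact (T4RelativeLadder.norm_inv_sub_inv_le (unitaryLike_qpTc_parSymY i q hVU s hz) (unitaryLike_qpTc_parSymY i q hU s hz)).trans
    (norm_qpTc_mul_sub_le i q hU hV hρ s hsmall hz)

/-- ★★★ **(3.57)–(3.59) FOR `Q′_□`, POINTWISE, CURRENCY U**: for unitary-like `U, U′`, `‖U′(b) − 1‖ ≤ ρ` at every bond based in the block `Δ(s)`, and any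
`D ≥ (d+1)(Lʲ⁽ˢ⁾ − 1)` (the contour length; own-level or the crude `(d+1)(Lᵏ − 1)`, `range_le_range_k`):
`‖(Q′_□(U′U)λ − Q′_□(U)λ)(s)‖ ≤ 2Dρ · Σ_z q′(s,z)‖λ(z)‖ = 2Dρ · (Q′_□‖λ‖)(s)` — print's `(F′_{2,j}(A)λ)(y)` with `F′₂ := Q′_□(U′U) − Q′_□(U)` ((3.57) is its
definition) and `|(F′₂λ)(y)| ≦ O(1)α₁(Q̃′_j|λ|)(y)` (3.59) (own-level smallness `ρ = O(1)α₁L^{−j}` gives the level-free `O(1)α₁`).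
[cite: Balaban1985BackgroundPropagators, (3.57) p.401, (3.58)–(3.59) p.402, (3.19) p.393, p.409 l.3–5] -/
theorem norm_QpCubeY_mul_sub_apply_le {U V : CfgY 𝔸 i} (hU : ∀ μ x, UnitaryLike (U μ x)) (hV : ∀ μ x, UnitaryLike (V μ x)) {ρ : ℝ} (hρ : 0 ≤ ρ)
    (s : BlkCubeY i q) {Da : ℕ} (hDa : (d + 1) * ((ℓ + 1) ^ s.1.1 - 1) ≤ Da)
    (hsmall : ∀ (ν : Fin (d + 1)) (v : Site (PV d ℓ i.m i.K hd hL) 0), blkOf (cubeFamY i q).toDomains (toBox i.hN v) = s → ‖(V ν v : 𝔸) - 1‖ ≤ ρ)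
    (lam : SiteY i → 𝔸) :
    ‖(QpCubeY i q (parSymY i) (fun μ x => V μ x * U μ x) lam - QpCubeY i q (parSymY i) U lam) s‖ ≤ 2 * Da * ρ * ∑ z, |qpKc i q s z| * ‖lam z‖ := by
  have hVU : ∀ μ x, UnitaryLike (V μ x * U μ x) := fun μ x => (hV μ x).mul (hU μ x)
  have h := norm_trLiftY_sub_apply_le (qpKc i q) (qpTc i q (parSymY i) (fun μ x => V μ x * U μ x)) (qpTc i q (parSymY i) U) lam s
    (τ := fun _ => (Da : ℝ) * ρ)
    (fun z hz => unitaryLike_qpTc_parSymY i q hVU s (blkOf_of_qpKc_ne_zero i q hz))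
    (fun z hz => unitaryLike_qpTc_parSymY i q hU s (blkOf_of_qpKc_ne_zero i q hz))
    (fun z hz => (norm_qpTc_mul_sub_le i q hU hV hρ s hsmall (blkOf_of_qpKc_ne_zero i q hz)).trans
      (mul_le_mul_of_nonneg_right (by exact_mod_cast hDa) hρ))
  refine h.trans (le_of_eq ?_)
  rw [Finset.mul_sum]
  refine Finset.sum_congr rfl fun z _ => ?_
  ring

/-- ★★★ **(3.57)–(3.59) FOR `Q′*_□`, POINTWISE, CURRENCY U** (transporters inverted; «F′*₂ is not an adjoint of F′₂» — it is bounded on its own): with the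
smallness on the block of `z` and `D ≥ (d+1)(Lʲ − 1)`, `j` the level of that block, `‖(Q′*_□(U′U)ν − Q′*_□(U)ν)(z)‖ ≤ 2Dρ · Σ_s q′*(z,s)‖ν(s)‖`
(one term: the block of `z`). [cite: Balaban1985BackgroundPropagators, (3.59) p.402 («a similar expansion for the adjoint operator»), (3.24) p.394, p.409 l.3–5] -/
theorem norm_QpsCubeY_mul_sub_apply_le {U V : CfgY 𝔸 i} (hU : ∀ μ x, UnitaryLike (U μ x)) (hV : ∀ μ x, UnitaryLike (V μ x)) {ρ : ℝ} (hρ : 0 ≤ ρ)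
    (z : SiteY i) {Da : ℕ} (hDa : (d + 1) * ((ℓ + 1) ^ (blkOf (cubeFamY i q).toDomains z).1.1 - 1) ≤ Da)
    (hsmall : ∀ (ν : Fin (d + 1)) (v : Site (PV d ℓ i.m i.K hd hL) 0),
      blkOf (cubeFamY i q).toDomains (toBox i.hN v) = blkOf (cubeFamY i q).toDomains z → ‖(V ν v : 𝔸) - 1‖ ≤ ρ)
    (nu : BlkCubeY i q → 𝔸) :
    ‖(QpsCubeY i q (parSymY i) (fun μ x => V μ x * U μ x) nu - QpsCubeY i q (parSymY i) U nu) z‖ ≤ 2 * Da * ρ * ∑ s, |qpsKc i q z s| * ‖nu s‖ := by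
  have hVU : ∀ μ x, UnitaryLike (V μ x * U μ x) := fun μ x => (hV μ x).mul (hU μ x)
  have h := norm_trLiftY_sub_apply_le (qpsKc i q) (fun z s => (qpTc i q (parSymY i) (fun μ x => V μ x * U μ x) s z)⁻¹)
    (fun z s => (qpTc i q (parSymY i) U s z)⁻¹) nu z (τ := fun _ => (Da : ℝ) * ρ)
    (fun s hs => (unitaryLike_qpTc_parSymY i q hVU s (blkOf_of_qpsKc_ne_zero i q hs)).inv)
    (fun s hs => (unitaryLike_qpTc_parSymY i q hU s (blkOf_of_qpsKc_ne_zero i q hs)).inv)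
    (fun s hs => by
      have hzs := blkOf_of_qpsKc_ne_zero i q hs
      refine (norm_inv_qpTc_mul_sub_le i q hU hV hρ s (fun ν v hv => hsmall ν v (hv.trans hzs.symm)) hzs).trans ?_
      refine mul_le_mul_of_nonneg_right ?_ hρ
      rw [← hzs]; exact_mod_cast hDa)
  refine h.trans (le_of_eq ?_)
  rw [Finset.mul_sum]
  refine Finset.sum_congr rfl fun s _ => ?_
  ring

/-- ★★ **GLOBAL-SMALLNESS FORM FOR `Q′_□`**: `‖U′(b) − 1‖ ≤ ρ` at EVERY bond ⟹ `‖(Q′_□(U′U)λ − Q′_□(U)λ)(s)‖ ≤ 2(d+1)(Lᵏ − 1)ρ · Σ_z q′(s,z)‖λ(z)‖`.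
[cite: Balaban1985BackgroundPropagators, (3.57)–(3.59) pp.401–402] -/
theorem norm_QpCubeY_mul_sub_apply_le_of_forall {U V : CfgY 𝔸 i} (hU : ∀ μ x, UnitaryLike (U μ x)) (hV : ∀ μ x, UnitaryLike (V μ x)) {ρ : ℝ} (hρ : 0 ≤ ρ)
    (hsmall : ∀ (ν : Fin (d + 1)) (v : Site (PV d ℓ i.m i.K hd hL) 0), ‖(V ν v : 𝔸) - 1‖ ≤ ρ) (lam : SiteY i → 𝔸) (s : BlkCubeY i q) :
    ‖(QpCubeY i q (parSymY i) (fun μ x => V μ x * U μ x) lam - QpCubeY i q (parSymY i) U lam) s‖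
      ≤ 2 * (((d + 1) * ((ℓ + 1) ^ i.k - 1) : ℕ) : ℝ) * ρ * ∑ z, |qpKc i q s z| * ‖lam z‖ :=
  norm_QpCubeY_mul_sub_apply_le i q hU hV hρ s (range_le_range_k i q s) (fun ν v _ => hsmall ν v) lam

/-- ★★ **GLOBAL-SMALLNESS FORM FOR `Q′*_□`**. [cite: Balaban1985BackgroundPropagators, (3.59) p.402] -/
theorem norm_QpsCubeY_mul_sub_apply_le_of_forall {U V : CfgY 𝔸 i} (hU : ∀ μ x, UnitaryLike (U μ x)) (hV : ∀ μ x, UnitaryLike (V μ x)) {ρ : ℝ} (hρ : 0 ≤ ρ)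
    (hsmall : ∀ (ν : Fin (d + 1)) (v : Site (PV d ℓ i.m i.K hd hL) 0), ‖(V ν v : 𝔸) - 1‖ ≤ ρ) (nu : BlkCubeY i q → 𝔸) (z : SiteY i) :
    ‖(QpsCubeY i q (parSymY i) (fun μ x => V μ x * U μ x) nu - QpsCubeY i q (parSymY i) U nu) z‖
      ≤ 2 * (((d + 1) * ((ℓ + 1) ^ i.k - 1) : ℕ) : ℝ) * ρ * ∑ s, |qpsKc i q z s| * ‖nu s‖ :=
  norm_QpsCubeY_mul_sub_apply_le i q hU hV hρ z (range_le_range_k i q _) (fun ν v _ => hsmall ν v) nu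

/-- ★★★ **THE BACKGROUND-`1` FACE FOR `Q′_□`** (the instance of the cube road: Cor. 3.6 gauges the background to `1` on `□̃`, the Sect.-B step is taken at
`U = 1` with the (3.37)-small `U′ = U^u`): for unitary-like `U′` with `‖U′(b) − 1‖ ≤ ρ` on the bonds based in `Δ(s)` and `D ≥ (d+1)(Lʲ⁽ˢ⁾ − 1)`,
`‖(Q′_□(U′)λ − Q′_□(1)λ)(s)‖ ≤ 2Dρ · Σ_z q′(s,z)‖λ(z)‖`. [cite: Balaban1985BackgroundPropagators, (3.57)–(3.59) pp.401–402, Cor. 3.5 p.407, Cor. 3.6 p.408] -/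
theorem norm_QpCubeY_sub_one_apply_le {V : CfgY 𝔸 i} (hV : ∀ μ x, UnitaryLike (V μ x)) {ρ : ℝ} (hρ : 0 ≤ ρ)
    (s : BlkCubeY i q) {Da : ℕ} (hDa : (d + 1) * ((ℓ + 1) ^ s.1.1 - 1) ≤ Da)
    (hsmall : ∀ (ν : Fin (d + 1)) (v : Site (PV d ℓ i.m i.K hd hL) 0), blkOf (cubeFamY i q).toDomains (toBox i.hN v) = s → ‖(V ν v : 𝔸) - 1‖ ≤ ρ)
    (lam : SiteY i → 𝔸) :
    ‖(QpCubeY i q (parSymY i) V lam - QpCubeY i q (parSymY i) 1 lam) s‖ ≤ 2 * Da * ρ * ∑ z, |qpKc i q s z| * ‖lam z‖ := by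
  have h := norm_QpCubeY_mul_sub_apply_le i q (U := 1) (fun _ _ => T4RelativeLadder.UnitaryLike.one) hV hρ s hDa hsmall lam
  rwa [mul_one_cfg] at h

/-- ★★★ **THE BACKGROUND-`1` FACE FOR `Q′*_□`**. [cite: Balaban1985BackgroundPropagators, (3.59) p.402, Cor. 3.5 p.407, Cor. 3.6 p.408] -/
theorem norm_QpsCubeY_sub_one_apply_le {V : CfgY 𝔸 i} (hV : ∀ μ x, UnitaryLike (V μ x)) {ρ : ℝ} (hρ : 0 ≤ ρ)
    (z : SiteY i) {Da : ℕ} (hDa : (d + 1) * ((ℓ + 1) ^ (blkOf (cubeFamY i q).toDomains z).1.1 - 1) ≤ Da)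
    (hsmall : ∀ (ν : Fin (d + 1)) (v : Site (PV d ℓ i.m i.K hd hL) 0),
      blkOf (cubeFamY i q).toDomains (toBox i.hN v) = blkOf (cubeFamY i q).toDomains z → ‖(V ν v : 𝔸) - 1‖ ≤ ρ)
    (nu : BlkCubeY i q → 𝔸) :
    ‖(QpsCubeY i q (parSymY i) V nu - QpsCubeY i q (parSymY i) 1 nu) z‖ ≤ 2 * Da * ρ * ∑ s, |qpsKc i q z s| * ‖nu s‖ := by
  have h := norm_QpsCubeY_mul_sub_apply_le i q (U := 1) (fun _ _ => T4RelativeLadder.UnitaryLike.one) hV hρ z hDa hsmall nu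
  rwa [mul_one_cfg] at h

/-- ★★ **GLOBAL-SMALLNESS, BACKGROUND `1`, BOTH LETTERS** — no geometry left for the consumer: for unitary-like `U′` with `‖U′(b) − 1‖ ≤ ρ` at every bond,
the two (3.59) sizes at `U = 1` with `O(1) = 2(d+1)(Lᵏ − 1)ρ`. [cite: Balaban1985BackgroundPropagators, (3.57)–(3.59) pp.401–402, Cor. 3.5 p.407] -/
theorem norm_QpCubeY_QpsCubeY_sub_one_apply_le_of_forall {V : CfgY 𝔸 i} (hV : ∀ μ x, UnitaryLike (V μ x)) {ρ : ℝ} (hρ : 0 ≤ ρ)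
    (hsmall : ∀ (ν : Fin (d + 1)) (v : Site (PV d ℓ i.m i.K hd hL) 0), ‖(V ν v : 𝔸) - 1‖ ≤ ρ) :
    (∀ (lam : SiteY i → 𝔸) (s : BlkCubeY i q), ‖(QpCubeY i q (parSymY i) V lam - QpCubeY i q (parSymY i) 1 lam) s‖
        ≤ 2 * (((d + 1) * ((ℓ + 1) ^ i.k - 1) : ℕ) : ℝ) * ρ * ∑ z, |qpKc i q s z| * ‖lam z‖) ∧
    (∀ (nu : BlkCubeY i q → 𝔸) (z : SiteY i), ‖(QpsCubeY i q (parSymY i) V nu - QpsCubeY i q (parSymY i) 1 nu) z‖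
        ≤ 2 * (((d + 1) * ((ℓ + 1) ^ i.k - 1) : ℕ) : ℝ) * ρ * ∑ s, |qpsKc i q z s| * ‖nu s‖) :=
  ⟨fun lam s => norm_QpCubeY_sub_one_apply_le i q hV hρ s (range_le_range_k i q s) (fun ν v _ => hsmall ν v) lam,
    fun nu z => norm_QpsCubeY_sub_one_apply_le i q hV hρ z (range_le_range_k i q _) (fun ν v _ => hsmall ν v) nu⟩

/-! ### The kernel letters in R1's shape (`B9Thm34GUniformR1`: `hkF : ‖kF y x‖ ≤ C_q·α₁·w(y)`, `hsF : ‖sF x‖ ≤ C_q·α₁`) -/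

omit [CompleteSpace 𝔸] [NormOneClass 𝔸] in
/-- the difference of two adjoint actions at unitary-like units, as `ℝ`-continuous-linear letters: `‖R(p′) − R(p)‖ ≤ 2‖p′ − p‖`.
[cite: Balaban1985BackgroundPropagators, (3.58) p.402, (3.1) p.390, bookkeeping] -/
theorem norm_Rclm_sub_le_of_unitaryLike {p' p : 𝔸ˣ} (hp' : UnitaryLike p') (hp : UnitaryLike p) :
    ‖Rclm p' - Rclm p‖ ≤ 2 * ‖(p' : 𝔸) - (p : 𝔸)‖ := by
  have h1 := norm_Rclm_sub_le p' p
  have h2 : ‖((p'⁻¹ : 𝔸ˣ) : 𝔸) - ((p⁻¹ : 𝔸ˣ) : 𝔸)‖ ≤ ‖(p' : 𝔸) - (p : 𝔸)‖ := T4RelativeLadder.norm_inv_sub_inv_le hp' hp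
  have h3 : ‖(p' : 𝔸) - (p : 𝔸)‖ * ‖((p'⁻¹ : 𝔸ˣ) : 𝔸)‖ ≤ ‖(p' : 𝔸) - (p : 𝔸)‖ * 1 := mul_le_mul_of_nonneg_left hp'.2 (norm_nonneg _)
  have h4 : ‖(p : 𝔸)‖ * ‖((p'⁻¹ : 𝔸ˣ) : 𝔸) - ((p⁻¹ : 𝔸ˣ) : 𝔸)‖ ≤ 1 * ‖(p' : 𝔸) - (p : 𝔸)‖ := mul_le_mul hp.1 h2 (norm_nonneg _) zero_le_one
  linarith

/-- ★★ **(3.58) AS R1's `hkF`**: the kernel letter of `F′₂ = Q′_□(U′U) − Q′_□(U)` — `kF(s, z) := q′(s, z)·(R((U′U)(Γ_{c_s,z})) − R(U(Γ_{c_s,z})))` — has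
`‖kF(s, z)‖ ≤ 4Dρ · q′(s, z)` (`= 4Dρ·W(s)⁻¹` on `Δ(s)`, `0` elsewhere): R1's `hkF` with `C_q·α₁ := 4Dρ`, `w(s) := W(s)⁻¹`, currency U.
[cite: Balaban1985BackgroundPropagators, (3.58) p.402, (3.19) p.393] -/
theorem norm_kernelLetter_QpCubeY_mul_sub_le {U V : CfgY 𝔸 i} (hU : ∀ μ x, UnitaryLike (U μ x)) (hV : ∀ μ x, UnitaryLike (V μ x)) {ρ : ℝ} (hρ : 0 ≤ ρ)
    (s : BlkCubeY i q) {Da : ℕ} (hDa : (d + 1) * ((ℓ + 1) ^ s.1.1 - 1) ≤ Da)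
    (hsmall : ∀ (ν : Fin (d + 1)) (v : Site (PV d ℓ i.m i.K hd hL) 0), blkOf (cubeFamY i q).toDomains (toBox i.hN v) = s → ‖(V ν v : 𝔸) - 1‖ ≤ ρ)
    (z : SiteY i) :
    ‖(qpKc i q s z) • (Rclm (qpTc i q (parSymY i) (fun μ x => V μ x * U μ x) s z) - Rclm (qpTc i q (parSymY i) U s z))‖ ≤ 4 * Da * ρ * qpKc i q s z := by
  by_cases hz : blkOf (cubeFamY i q).toDomains z = s
  · have hVU : ∀ μ x, UnitaryLike (V μ x * U μ x) := fun μ x => (hV μ x).mul (hU μ x)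
    have h1 := norm_Rclm_sub_le_of_unitaryLike (unitaryLike_qpTc_parSymY i q hVU s hz) (unitaryLike_qpTc_parSymY i q hU s hz)
    have h2 := (norm_qpTc_mul_sub_le i q hU hV hρ s hsmall hz).trans (mul_le_mul_of_nonneg_right (show (((d + 1) * ((ℓ + 1) ^ s.1.1 - 1) : ℕ) : ℝ) ≤ Da by exact_mod_cast hDa) hρ)
    rw [norm_smul, Real.norm_eq_abs, abs_of_nonneg (qpKc_nonneg i q s z)]
    have hq := qpKc_nonneg i q s z
    calc qpKc i q s z * ‖Rclm (qpTc i q (parSymY i) (fun μ x => V μ x * U μ x) s z) - Rclm (qpTc i q (parSymY i) U s z)‖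
        ≤ qpKc i q s z * (2 * ((Da : ℝ) * ρ)) := mul_le_mul_of_nonneg_left (h1.trans (by linarith)) hq
      _ ≤ 4 * Da * ρ * qpKc i q s z := by nlinarith [mul_nonneg (Nat.cast_nonneg Da) hρ]
  · rw [norm_smul, qpKc_of_blkOf_ne i q hz, Real.norm_eq_abs, abs_zero, zero_mul, mul_zero]

/-- ★★ **(3.59)'s starred letter AS R1's `hsF`**: the letter of `F′*₂ = Q′*_□(U′U) − Q′*_□(U)` at `z ∈ Δ(s)` — `sF(z) := R(((U′U)(Γ_{c_s,z}))⁻¹) − R((U(Γ_{c_s,z}))⁻¹)` — has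
`‖sF(z)‖ ≤ 4Dρ`: R1's `hsF` with `C_q·α₁ := 4Dρ`, currency U. [cite: Balaban1985BackgroundPropagators, (3.59) p.402 («a similar expansion for the adjoint operator»), (3.24) p.394] -/
theorem norm_starLetter_QpsCubeY_mul_sub_le {U V : CfgY 𝔸 i} (hU : ∀ μ x, UnitaryLike (U μ x)) (hV : ∀ μ x, UnitaryLike (V μ x)) {ρ : ℝ} (hρ : 0 ≤ ρ)
    (s : BlkCubeY i q) {Da : ℕ} (hDa : (d + 1) * ((ℓ + 1) ^ s.1.1 - 1) ≤ Da)
    (hsmall : ∀ (ν : Fin (d + 1)) (v : Site (PV d ℓ i.m i.K hd hL) 0), blkOf (cubeFamY i q).toDomains (toBox i.hN v) = s → ‖(V ν v : 𝔸) - 1‖ ≤ ρ)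
    {z : SiteY i} (hz : blkOf (cubeFamY i q).toDomains z = s) :
    ‖Rclm (qpTc i q (parSymY i) (fun μ x => V μ x * U μ x) s z)⁻¹ - Rclm (qpTc i q (parSymY i) U s z)⁻¹‖ ≤ 4 * Da * ρ := by
  have hVU : ∀ μ x, UnitaryLike (V μ x * U μ x) := fun μ x => (hV μ x).mul (hU μ x)
  have h1 := norm_Rclm_sub_le_of_unitaryLike (unitaryLike_qpTc_parSymY i q hVU s hz).inv (unitaryLike_qpTc_parSymY i q hU s hz).inv
  have h2 := (norm_inv_qpTc_mul_sub_le i q hU hV hρ s hsmall hz).trans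
    (mul_le_mul_of_nonneg_right (show (((d + 1) * ((ℓ + 1) ^ s.1.1 - 1) : ℕ) : ℝ) ≤ Da by exact_mod_cast hDa) hρ)
  have h0 : 0 ≤ (Da : ℝ) * ρ := mul_nonneg (Nat.cast_nonneg _) hρ
  linarith

end CurrencyU

/-! ## §3 CURRENCY A (N06's): the multiplier `e^{iηa}` with the own-level (3.37) on the block, complex `a` allowed -/

section CurrencyA

variable {𝔸 : Type} [NormedRing 𝔸] [NormedAlgebra ℂ 𝔸] [CompleteSpace 𝔸] [NormOneClass 𝔸]
variable (i : KIdx d ℓ hd hL b₀ b₁) (q : ↥(cubes (toKT i).D.toDomains)) (G : Subgroup 𝔸ˣ)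

/-- the level-free constant `O(1) = 4(d+1)e^{3(d+1)/2}` of (3.58)∕(3.59) in currency A (N06's). [cite: Balaban1985BackgroundPropagators, (3.58) p.402 («O(1)»)] -/
theorem const358_nonneg : 0 ≤ 4 * ((d : ℝ) + 1) * Real.exp (3 * (((d : ℝ) + 1) / 2)) := by positivity

/-- ★★ **THE KEY ESTIMATE OF p. 401, CURRENCY A, FOR THE CUBE SEQUENCE's BLOCKS**: for a `G`-valued (unit-norm) `U`, a multiplier `e^{iηa}` with
`η‖a_ν(v)‖ ≤ α₁·L^{−j(s)}` at every bond based in the block `Δ(s)` (the block's own-level (3.37), complex `a` allowed), `α₁ ≤ 1/4`, and two torus points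
within `Lʲ⁽ˢ⁾` forward steps of the corner: along the taxicab contour `Γ_{x₁,x₂}`, `‖(e^{iηa}U)(Γ) − U(Γ)‖ ≤ 2(d+1)e^{(d+1)/2}·α₁`,
`‖((e^{iηa}U)(Γ))⁻¹ − (U(Γ))⁻¹‖ ≤ e^{(d+1)/2}·2(d+1)e^{(d+1)/2}·α₁`, `‖(e^{iηa}U)(Γ)‖, ‖((e^{iηa}U)(Γ))⁻¹‖ ≤ e^{(d+1)/2}` (N06's
`B9Eq358TaxiLettersY.norm_parTaxiV_prod_sub_le`, re-keyed from the member's blocks to the cube sequence's).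
[cite: Balaban1985BackgroundPropagators, p.401 («|(U′U)(Γ)(U(Γ))⁻¹ − 1| < O(1)α₁»), (3.37) p.396, (3.40) p.397, p.408] -/
theorem norm_parTaxiV_prod_sub_block_le (hG1 : ∀ u : 𝔸ˣ, u ∈ G → ‖(u : 𝔸)‖ ≤ 1) {U : CfgY 𝔸 i} (hU : ∀ μ x, U μ x ∈ G)
    {η : ℝ} (hη : 0 ≤ η) (a : AfldY 𝔸 i) (s : BlkCubeY i q) {α₁ : ℝ} (hα₁ : 0 ≤ α₁) (hα₁4 : α₁ ≤ 1 / 4)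
    (ha : ∀ (ν : Fin (d + 1)) (v : Site (PV d ℓ i.m i.K hd hL) 0), blkOf (cubeFamY i q).toDomains (toBox i.hN v) = s →
      η * ‖a ν v‖ ≤ α₁ * ((((ℓ + 1) ^ s.1.1 : ℕ) : ℝ))⁻¹)
    (x₁ x₂ : Site (PV d ℓ i.m i.K hd hL) 0)
    (h₁ : ∀ μ, (x₁ μ - ((boxEquiv i.hN).symm (blkCornerCubeY i q s)) μ).val < (ℓ + 1) ^ s.1.1)
    (h₂ : ∀ μ, (x₂ μ - ((boxEquiv i.hN).symm (blkCornerCubeY i q s)) μ).val < (ℓ + 1) ^ s.1.1) :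
    ‖((parTaxiV (mulY i (fluct η a) U) x₁ x₂ : 𝔸ˣ) : 𝔸) - (parTaxiV U x₁ x₂ : 𝔸)‖
        ≤ 2 * ((d : ℝ) + 1) * Real.exp (((d : ℝ) + 1) / 2) * α₁ ∧
      ‖(((parTaxiV (mulY i (fluct η a) U) x₁ x₂)⁻¹ : 𝔸ˣ) : 𝔸) - (((parTaxiV U x₁ x₂)⁻¹ : 𝔸ˣ) : 𝔸)‖
        ≤ Real.exp (((d : ℝ) + 1) / 2) * (2 * ((d : ℝ) + 1) * Real.exp (((d : ℝ) + 1) / 2) * α₁) ∧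
      ‖((parTaxiV (mulY i (fluct η a) U) x₁ x₂ : 𝔸ˣ) : 𝔸)‖ ≤ Real.exp (((d : ℝ) + 1) / 2) ∧
      ‖(((parTaxiV (mulY i (fluct η a) U) x₁ x₂)⁻¹ : 𝔸ˣ) : 𝔸)‖ ≤ Real.exp (((d : ℝ) + 1) / 2) := by
  have hLj : 0 < (ℓ + 1) ^ s.1.1 := by positivity
  set l := taxiSteps (List.finRange (d + 1)) x₁ x₂ with hl
  have hW : parTaxiV (mulY i (fluct η a) U) x₁ x₂ = stepRun (fun μ x => fluct η a μ x * U μ x) l x₁ := parTaxiV_eq_stepRun _ x₁ x₂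
  have hUr : parTaxiV U x₁ x₂ = stepRun U l x₁ := parTaxiV_eq_stepRun U x₁ x₂
  have hUu : ∀ μ x, UnitaryLike (U μ x) := fun μ x => norm_le_one_and_inv_of_mem G hG1 (hU μ x)
  set ε : ℝ := 2 * α₁ * ((((ℓ + 1) ^ s.1.1 : ℕ) : ℝ))⁻¹ with hε
  have hε0 : 0 ≤ ε := by positivity
  have hx4 : α₁ * ((((ℓ + 1) ^ s.1.1 : ℕ) : ℝ))⁻¹ ≤ 1 / 4 := by
    have hL1 : (1 : ℝ) ≤ (((ℓ + 1) ^ s.1.1 : ℕ) : ℝ) := by exact_mod_cast hLj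
    have : ((((ℓ + 1) ^ s.1.1 : ℕ) : ℝ))⁻¹ ≤ 1 := inv_le_one_of_one_le₀ hL1
    nlinarith
  have hrung : ∀ r ∈ rungSites l x₁, ‖((fluct η a r.2.1 r.1 : 𝔸ˣ) : 𝔸) - 1‖ ≤ ε ∧ ‖(((fluct η a r.2.1 r.1)⁻¹ : 𝔸ˣ) : 𝔸) - 1‖ ≤ ε := by
    intro r hr
    have hblk := blkOf_toBox_rung_eq i q s x₁ x₂ h₁ h₂ r hr
    have h := norm_fluct_sub_one_le i hη a r.2.1 r.1 (ha r.2.1 r.1 hblk) hx4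
    rw [hε]
    exact ⟨h.1.trans (le_of_eq (by ring)), h.2.trans (le_of_eq (by ring))⟩
  have hrungb : ∀ r ∈ rungSites l x₁, ‖((fluct η a r.2.1 r.1 : 𝔸ˣ) : 𝔸)‖ ≤ 1 + ε ∧ ‖(((fluct η a r.2.1 r.1)⁻¹ : 𝔸ˣ) : 𝔸)‖ ≤ 1 + ε := by
    intro r hr
    obtain ⟨e1, e2⟩ := hrung r hr
    exact ⟨by simpa using (norm_le_norm_add_norm_sub' ((fluct η a r.2.1 r.1 : 𝔸ˣ) : 𝔸) 1).trans (by rw [norm_one]; linarith),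
      by simpa using (norm_le_norm_add_norm_sub' (((fluct η a r.2.1 r.1)⁻¹ : 𝔸ˣ) : 𝔸) 1).trans (by rw [norm_one]; linarith)⟩
  have hlen : l.length ≤ (d + 1) * ((ℓ + 1) ^ s.1.1 - 1) := length_taxiSteps_block_le i q s x₁ x₂ h₁ h₂
  obtain ⟨hP0, hP1⟩ := pow_bounds (d := d) hα₁ hα₁4 hLj hlen
  have hε' : (1 + 2 * α₁ * ((((ℓ + 1) ^ s.1.1 : ℕ) : ℝ))⁻¹) = 1 + ε := by rw [hε]
  rw [hε'] at hP0 hP1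
  have hA := norm_stepRun_prod_sub_le hUu hε0 l x₁ hrung
  have hB := norm_inv_stepRun_prod_sub_le hUu hε0 l x₁ hrung
  have hC := norm_stepRun_prod_le hUu hε0 l x₁ hrungb
  have hD := norm_inv_stepRun_prod_le hUu hε0 l x₁ hrungb
  rw [hW, hUr]
  refine ⟨hA.trans hP1, hB.trans ?_, hC.trans hP0, hD.trans hP0⟩
  have h0 : 0 ≤ (1 + ε) ^ l.length - 1 := by
    have := one_le_pow₀ (show (1 : ℝ) ≤ 1 + ε by linarith) (n := l.length); linarith
  exact mul_le_mul hP0 hP1 h0 (Real.exp_nonneg _)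

/-- ★★ **(3.58), CURRENCY A, FOR THE CUBE LETTERS**: on the block, the `ℝ`-linear letters of the two transporters of `Q′_□` differ by at most
`4(d+1)e^{3(d+1)/2}·α₁` in operator norm, and so do those of the INVERSE transporters (the letters of `Q′*_□`).
[cite: Balaban1985BackgroundPropagators, (3.58) p.402, (3.59) p.402 («a similar expansion for the adjoint operator»), (3.37) p.396] -/
theorem norm_Rclm_qpTc_prod_sub_le (hG1 : ∀ u : 𝔸ˣ, u ∈ G → ‖(u : 𝔸)‖ ≤ 1) {U : CfgY 𝔸 i} (hU : ∀ μ x, U μ x ∈ G)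
    {η : ℝ} (hη : 0 ≤ η) (a : AfldY 𝔸 i) (s : BlkCubeY i q) {α₁ : ℝ} (hα₁ : 0 ≤ α₁) (hα₁4 : α₁ ≤ 1 / 4)
    (ha : ∀ (ν : Fin (d + 1)) (v : Site (PV d ℓ i.m i.K hd hL) 0), blkOf (cubeFamY i q).toDomains (toBox i.hN v) = s →
      η * ‖a ν v‖ ≤ α₁ * ((((ℓ + 1) ^ s.1.1 : ℕ) : ℝ))⁻¹)
    {z : SiteY i} (hz : blkOf (cubeFamY i q).toDomains z = s) :
    ‖Rclm (qpTc i q (parSymY i) (mulY i (fluct η a) U) s z) - Rclm (qpTc i q (parSymY i) U s z)‖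
        ≤ 4 * ((d : ℝ) + 1) * Real.exp (3 * (((d : ℝ) + 1) / 2)) * α₁ ∧
      ‖Rclm (qpTc i q (parSymY i) (mulY i (fluct η a) U) s z)⁻¹ - Rclm (qpTc i q (parSymY i) U s z)⁻¹‖
        ≤ 4 * ((d : ℝ) + 1) * Real.exp (3 * (((d : ℝ) + 1) / 2)) * α₁ := by
  have hUu : ∀ μ x, UnitaryLike (U μ x) := fun μ x => norm_le_one_and_inv_of_mem G hG1 (hU μ x)
  set p := (boxEquiv i.hN).symm (blkCornerCubeY i q s)
  set t := (boxEquiv i.hN).symm z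
  have hW : qpTc i q (parSymY i) (mulY i (fluct η a) U) s z = parTaxiV (mulY i (fluct η a) U) p t := qpTc_parSymY_of_blkOf_eq i q _ s hz
  have hV : qpTc i q (parSymY i) U s z = parTaxiV U p t := qpTc_parSymY_of_blkOf_eq i q _ s hz
  obtain ⟨hA, hB, hC, hD⟩ := norm_parTaxiV_prod_sub_block_le i q G hG1 hU hη a s hα₁ hα₁4 ha p t (val_sub_corner_self i q s)
    (fun μ => (val_sub_corner i q s hz μ).2)
  set q' : 𝔸ˣ := parTaxiV (mulY i (fluct η a) U) p t
  set q₀ : 𝔸ˣ := parTaxiV U p t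
  have hq : ‖(q₀ : 𝔸)‖ ≤ 1 := by
    rw [show q₀ = parTaxiV U p t from rfl, parTaxiV_eq_stepRun]; exact (unitaryLike_stepRun hUu _ _).1
  have hqi : ‖((q₀⁻¹ : 𝔸ˣ) : 𝔸)‖ ≤ 1 := by
    rw [show q₀ = parTaxiV U p t from rfl, parTaxiV_eq_stepRun]; exact (unitaryLike_stepRun hUu _ _).2
  set C₀ : ℝ := Real.exp (((d : ℝ) + 1) / 2) with hC₀
  have hC₀1 : 1 ≤ C₀ := Real.one_le_exp (by positivity)
  have hC₀0 : 0 ≤ C₀ := zero_le_one.trans hC₀1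
  have hE3 : Real.exp (3 * (((d : ℝ) + 1) / 2)) = C₀ * C₀ * C₀ := by
    rw [hC₀, ← Real.exp_add, ← Real.exp_add]; ring_nf
  have hpos : 0 ≤ 2 * ((d : ℝ) + 1) * α₁ * C₀ := by positivity
  have hsq : 1 ≤ C₀ * C₀ := one_le_mul_of_one_le_of_one_le hC₀1 hC₀1
  rw [hW, hV]
  constructor
  · calc ‖Rclm q' - Rclm q₀‖ ≤ ‖(q' : 𝔸) - (q₀ : 𝔸)‖ * ‖((q'⁻¹ : 𝔸ˣ) : 𝔸)‖ + ‖(q₀ : 𝔸)‖ * ‖((q'⁻¹ : 𝔸ˣ) : 𝔸) - ((q₀⁻¹ : 𝔸ˣ) : 𝔸)‖ :=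
          norm_Rclm_sub_le q' q₀
      _ ≤ (2 * ((d : ℝ) + 1) * C₀ * α₁) * C₀ + 1 * (C₀ * (2 * ((d : ℝ) + 1) * C₀ * α₁)) := by gcongr
      _ = (2 * ((d : ℝ) + 1) * α₁ * C₀) * (C₀ + C₀) := by ring
      _ ≤ (2 * ((d : ℝ) + 1) * α₁ * C₀) * (C₀ * C₀ + C₀ * C₀) := mul_le_mul_of_nonneg_left (by nlinarith) hpos
      _ = 4 * ((d : ℝ) + 1) * Real.exp (3 * (((d : ℝ) + 1) / 2)) * α₁ := by rw [hE3]; ring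
  · calc ‖Rclm q'⁻¹ - Rclm q₀⁻¹‖
        ≤ ‖((q'⁻¹ : 𝔸ˣ) : 𝔸) - ((q₀⁻¹ : 𝔸ˣ) : 𝔸)‖ * ‖((q'⁻¹⁻¹ : 𝔸ˣ) : 𝔸)‖ + ‖((q₀⁻¹ : 𝔸ˣ) : 𝔸)‖ * ‖((q'⁻¹⁻¹ : 𝔸ˣ) : 𝔸) - ((q₀⁻¹⁻¹ : 𝔸ˣ) : 𝔸)‖ :=
          norm_Rclm_sub_le q'⁻¹ q₀⁻¹
      _ = ‖((q'⁻¹ : 𝔸ˣ) : 𝔸) - ((q₀⁻¹ : 𝔸ˣ) : 𝔸)‖ * ‖(q' : 𝔸)‖ + ‖((q₀⁻¹ : 𝔸ˣ) : 𝔸)‖ * ‖(q' : 𝔸) - (q₀ : 𝔸)‖ := by rw [inv_inv, inv_inv]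
      _ ≤ (C₀ * (2 * ((d : ℝ) + 1) * C₀ * α₁)) * C₀ + 1 * (2 * ((d : ℝ) + 1) * C₀ * α₁) := by gcongr
      _ = (2 * ((d : ℝ) + 1) * α₁ * C₀) * (C₀ * C₀ + 1) := by ring
      _ ≤ (2 * ((d : ℝ) + 1) * α₁ * C₀) * (C₀ * C₀ + C₀ * C₀) := mul_le_mul_of_nonneg_left (by linarith) hpos
      _ = 4 * ((d : ℝ) + 1) * Real.exp (3 * (((d : ℝ) + 1) / 2)) * α₁ := by rw [hE3]; ring

omit [CompleteSpace 𝔸] [NormOneClass 𝔸] in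
/-- the transported lift is Lipschitz in its transporters through their `ℝ`-linear letters (no unitarity needed): if `‖R(T(y,x)) − R(T′(y,x))‖ ≤ τ(x)` on the
support of the row, then `‖(M♯_T Λ − M♯_{T′} Λ)(y)‖ ≤ Σ_x |M(y,x)|·τ(x)·‖Λ(x)‖`. [cite: Balaban1985BackgroundPropagators, (3.57)–(3.59) pp.401–402, (3.19) p.393] -/
theorem norm_trLiftY_sub_apply_le_of_Rclm {X Y : Type} [Fintype X] (M : Matrix Y X ℝ) (T T' : Y → X → 𝔸ˣ) (Λ : X → 𝔸) (y : Y) {τ : X → ℝ}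
    (hτ : ∀ x, M y x ≠ 0 → ‖Rclm (T y x) - Rclm (T' y x)‖ ≤ τ x) :
    ‖(trLiftY M T Λ - trLiftY M T' Λ) y‖ ≤ ∑ x, |M y x| * (τ x * ‖Λ x‖) := by
  rw [trLiftY_sub_trLiftY_apply]
  refine (norm_sum_le _ _).trans (Finset.sum_le_sum fun x _ => ?_)
  by_cases hx : M y x = 0
  · simp [hx]
  · rw [norm_smul, Complex.norm_real, Real.norm_eq_abs]
    refine mul_le_mul_of_nonneg_left ?_ (abs_nonneg _)
    have e : R (T y x) (Λ x) - R (T' y x) (Λ x) = (Rclm (T y x) - Rclm (T' y x)) (Λ x) := by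
      rw [← Rclm_apply, ← Rclm_apply]; rfl
    rw [e]
    exact ((Rclm (T y x) - Rclm (T' y x)).le_opNorm (Λ x)).trans (mul_le_mul_of_nonneg_right (hτ x hx) (norm_nonneg _))

/-- ★★★ **(3.57)–(3.59) FOR `Q′_□`, POINTWISE, CURRENCY A**: for a `G`-valued `U` (`G` norm-bounded by `1`), the multiplier `e^{iηa}` with the own-level
(3.37) `η‖a_ν(v)‖ ≤ α₁L^{−j(s)}` on the bonds based in `Δ(s)` (complex `a` allowed) and `α₁ ≤ 1/4`:
`‖(Q′_□(e^{iηa}U)λ − Q′_□(U)λ)(s)‖ ≤ 4(d+1)e^{3(d+1)/2}·α₁ · Σ_z q′(s,z)‖λ(z)‖` — print's `|(F′_{2,j}(A)λ)(y)| ≦ O(1)α₁(Q̃′_j|λ|)(y)` (3.59) with the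
level-free `O(1) = 4(d+1)e^{3(d+1)/2}`. [cite: Balaban1985BackgroundPropagators, (3.57) p.401, (3.58)–(3.59) p.402, (3.37) p.396, p.409 l.3–5] -/
theorem norm_QpCubeY_prod_sub_apply_le (hG1 : ∀ u : 𝔸ˣ, u ∈ G → ‖(u : 𝔸)‖ ≤ 1) {U : CfgY 𝔸 i} (hU : ∀ μ x, U μ x ∈ G)
    {η : ℝ} (hη : 0 ≤ η) (a : AfldY 𝔸 i) (s : BlkCubeY i q) {α₁ : ℝ} (hα₁ : 0 ≤ α₁) (hα₁4 : α₁ ≤ 1 / 4)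
    (ha : ∀ (ν : Fin (d + 1)) (v : Site (PV d ℓ i.m i.K hd hL) 0), blkOf (cubeFamY i q).toDomains (toBox i.hN v) = s →
      η * ‖a ν v‖ ≤ α₁ * ((((ℓ + 1) ^ s.1.1 : ℕ) : ℝ))⁻¹)
    (lam : SiteY i → 𝔸) :
    ‖(QpCubeY i q (parSymY i) (mulY i (fluct η a) U) lam - QpCubeY i q (parSymY i) U lam) s‖
      ≤ 4 * ((d : ℝ) + 1) * Real.exp (3 * (((d : ℝ) + 1) / 2)) * α₁ * ∑ z, |qpKc i q s z| * ‖lam z‖ := by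
  have h := norm_trLiftY_sub_apply_le_of_Rclm (qpKc i q) (qpTc i q (parSymY i) (mulY i (fluct η a) U)) (qpTc i q (parSymY i) U) lam s
    (τ := fun _ => 4 * ((d : ℝ) + 1) * Real.exp (3 * (((d : ℝ) + 1) / 2)) * α₁)
    (fun z hz => (norm_Rclm_qpTc_prod_sub_le i q G hG1 hU hη a s hα₁ hα₁4 ha (blkOf_of_qpKc_ne_zero i q hz)).1)
  refine h.trans (le_of_eq ?_)
  rw [Finset.mul_sum]
  refine Finset.sum_congr rfl fun z _ => ?_
  ring

/-- ★★★ **(3.57)–(3.59) FOR `Q′*_□`, POINTWISE, CURRENCY A**: with the own-level (3.37) on the block of `z`,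
`‖(Q′*_□(e^{iηa}U)ν − Q′*_□(U)ν)(z)‖ ≤ 4(d+1)e^{3(d+1)/2}·α₁ · Σ_s q′*(z,s)‖ν(s)‖`.
[cite: Balaban1985BackgroundPropagators, (3.59) p.402 («a similar expansion for the adjoint operator»), (3.24) p.394, (3.37) p.396] -/
theorem norm_QpsCubeY_prod_sub_apply_le (hG1 : ∀ u : 𝔸ˣ, u ∈ G → ‖(u : 𝔸)‖ ≤ 1) {U : CfgY 𝔸 i} (hU : ∀ μ x, U μ x ∈ G)
    {η : ℝ} (hη : 0 ≤ η) (a : AfldY 𝔸 i) (z : SiteY i) {α₁ : ℝ} (hα₁ : 0 ≤ α₁) (hα₁4 : α₁ ≤ 1 / 4)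
    (ha : ∀ (ν : Fin (d + 1)) (v : Site (PV d ℓ i.m i.K hd hL) 0),
      blkOf (cubeFamY i q).toDomains (toBox i.hN v) = blkOf (cubeFamY i q).toDomains z →
        η * ‖a ν v‖ ≤ α₁ * ((((ℓ + 1) ^ (blkOf (cubeFamY i q).toDomains z).1.1 : ℕ) : ℝ))⁻¹)
    (nu : BlkCubeY i q → 𝔸) :
    ‖(QpsCubeY i q (parSymY i) (mulY i (fluct η a) U) nu - QpsCubeY i q (parSymY i) U nu) z‖
      ≤ 4 * ((d : ℝ) + 1) * Real.exp (3 * (((d : ℝ) + 1) / 2)) * α₁ * ∑ s, |qpsKc i q z s| * ‖nu s‖ := by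
  have h := norm_trLiftY_sub_apply_le_of_Rclm (qpsKc i q) (fun z s => (qpTc i q (parSymY i) (mulY i (fluct η a) U) s z)⁻¹)
    (fun z s => (qpTc i q (parSymY i) U s z)⁻¹) nu z (τ := fun _ => 4 * ((d : ℝ) + 1) * Real.exp (3 * (((d : ℝ) + 1) / 2)) * α₁)
    (fun s hs => by
      have hzs := blkOf_of_qpsKc_ne_zero i q hs
      have ha' : ∀ (ν : Fin (d + 1)) (v : Site (PV d ℓ i.m i.K hd hL) 0), blkOf (cubeFamY i q).toDomains (toBox i.hN v) = s →
          η * ‖a ν v‖ ≤ α₁ * ((((ℓ + 1) ^ s.1.1 : ℕ) : ℝ))⁻¹ := fun ν v hv => by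
        have h := ha ν v (hv.trans hzs.symm); rwa [hzs] at h
      exact (norm_Rclm_qpTc_prod_sub_le i q G hG1 hU hη a s hα₁ hα₁4 ha' hzs).2)
  refine h.trans (le_of_eq ?_)
  rw [Finset.mul_sum]
  refine Finset.sum_congr rfl fun s _ => ?_
  ring

/-- ★★ **R1's `hkF` IN CURRENCY A**: `‖q′(s,z)·(R((e^{iηa}U)(Γ_{c_s,z})) − R(U(Γ_{c_s,z})))‖ ≤ 4(d+1)e^{3(d+1)/2}α₁ · q′(s,z)` (`= …·W(s)⁻¹` on `Δ(s)`, `0`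
elsewhere): `C_q·α₁` with `C_q = 4(d+1)e^{3(d+1)/2}`, `w(s) = W(s)⁻¹`. [cite: Balaban1985BackgroundPropagators, (3.58) p.402, (3.19) p.393, (3.37) p.396] -/
theorem norm_kernelLetter_QpCubeY_prod_sub_le (hG1 : ∀ u : 𝔸ˣ, u ∈ G → ‖(u : 𝔸)‖ ≤ 1) {U : CfgY 𝔸 i} (hU : ∀ μ x, U μ x ∈ G)
    {η : ℝ} (hη : 0 ≤ η) (a : AfldY 𝔸 i) (s : BlkCubeY i q) {α₁ : ℝ} (hα₁ : 0 ≤ α₁) (hα₁4 : α₁ ≤ 1 / 4)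
    (ha : ∀ (ν : Fin (d + 1)) (v : Site (PV d ℓ i.m i.K hd hL) 0), blkOf (cubeFamY i q).toDomains (toBox i.hN v) = s →
      η * ‖a ν v‖ ≤ α₁ * ((((ℓ + 1) ^ s.1.1 : ℕ) : ℝ))⁻¹)
    (z : SiteY i) :
    ‖(qpKc i q s z) • (Rclm (qpTc i q (parSymY i) (mulY i (fluct η a) U) s z) - Rclm (qpTc i q (parSymY i) U s z))‖
      ≤ 4 * ((d : ℝ) + 1) * Real.exp (3 * (((d : ℝ) + 1) / 2)) * α₁ * qpKc i q s z := by
  by_cases hz : blkOf (cubeFamY i q).toDomains z = s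
  · have h1 := (norm_Rclm_qpTc_prod_sub_le i q G hG1 hU hη a s hα₁ hα₁4 ha hz).1
    rw [norm_smul, Real.norm_eq_abs, abs_of_nonneg (qpKc_nonneg i q s z), mul_comm]
    exact mul_le_mul_of_nonneg_right h1 (qpKc_nonneg i q s z)
  · rw [norm_smul, qpKc_of_blkOf_ne i q hz, Real.norm_eq_abs, abs_zero, zero_mul, mul_zero]

end CurrencyA


end Literature.MathematicalPhysics.QuantumFieldTheory.Balaban1983to89.B9Eq357CubeLetters

end
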